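import Literature.MathematicalPhysics.QuantumFieldTheory.Balaban1983to89.B4Cor23TorusPairFam
import Literature.MathematicalPhysics.QuantumFieldTheory.Balaban1983to89.B4Prop23RegularWindow
import Literature.MathematicalPhysics.QuantumFieldTheory.Balaban1983to89.B4Lemma22RegFlows
import Literature.MathematicalPhysics.QuantumFieldTheory.Balaban1983to89.B4Sect5Proof

/-!
# `Balaban1983to89.B4LeafRegular` — [Balaban1983RegularityDecay]: THE FOUR STATEMENTS THE PAPER CONTRIBUTES TO THE
# SERIES DAG (Theorem p. 573 · «Proposition 2.3 of [1]» · «Proposition 3.1′ of [2]» · the Sect. 5 Theorem) — AND ITS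
# OTHER NAMED STATEMENTS ((1.8), Lemma 2.1, Lemma 2.2, Corollary 2.3) — ALL INHABITED AT A (1.7)-REGULAR BACKGROUND
# FIELD `A ≠ 0` ON THE LINEAGE'S CONCRETE FAMILIES, BY NAME (knitting; theorems only)

statement-level skeleton of published theorems with citation tags; proofs where landed; nothing here is a claim about the Yang–Mills mass gap

CITATION HEADER.  T. Bałaban, *Regularity and decay of lattice Green's functions*, Commun. Math. Phys. **89** (1983)
571–597, doi:10.1007/bf01214744 [Balaban1983RegularityDecay] (cell paper B4; held text
`paper:balaban1983-cmp89-regularity-decay`, journal page = PDF page + 570; pp. 572–574 [PDF 2–4] re-read by this seat).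
Unit `lit-balaban-r01` gen 11 (B4 fold owner; HOME `run/shared/lean/pub/lit-balaban/`), SKELETON rows **B4.Thm@573**,
**B4.Prop2.3[I]**, **B4.Prop3.1'[II]**, **B4.Thm@594** (the four conjuncts of the series-DAG leaf `b4`), and B4.Eq1.8,
B4.Lem2.1, B4.Lem2.2, B4.Cor2.3 (the companions).  EVERYTHING MATHEMATICAL BELOW IS AN EXISTING KERNEL THEOREM OF THE
TREE, USED BY NAME: r01 g9 `B4ThmTorusPairEta.thmPrintedNN_torusPairFam` / r01 g8
`B4ThmRegionPairEta.thmPrintedNN_regionPairFam` (Theorem p. 573 in pv17's typed `η`-uniform form `ThmPrintedNN`), p17 g3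
`B4Prop23RegularWindow.prop23Printed_regularWindow` («Prop. 2.3 of [1]», printed §5 route), p35 g2
`B4Prop31Regular.prop31Printed_regularRegion` («Prop. 3.1′ of [2]»), pv23 (cell pub-balaban) `B4Sect5Proof.sect5ThmUniform_holds`
(Sect. 5 Theorem), r01 g8/g9 `claim18Printed_regionPairFam` / `claim18Printed_torusPairFam` ((1.8)), the b2b lineage's
`B4Lemma21Region.lemma21Printed_regularRegion` (Lemma 2.1), p35 g7 `B4Lemma22RegularCubeFam.lemma22Printed_cubeFieldFam`
/ `B4Lemma22RegFieldFam.lemma22Printed_regFieldFam` (Lemma 2.2), r01 g10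
`B4Cor23RegionPairFam.cor23Printed_regionPairFam` / `B4Cor23TorusPairFam.cor23Printed_torusPairFam` (Cor. 2.3), and
r01 g5 `B4Eq12ExpFlow.expFlow_lipschitz` (the printed link variables (1.2) meet the flow hypothesis of all of them).
New here: only the two NON-VACUITY lemmas of §2 for the Prop. 2.3 / Prop. 3.1′ families and the assembly.
v1.1 (DOCSTRING-ONLY; every declaration byte-identical): two seat attributions in this header corrected (`B4Sect5Proof` is
unit pv23 of cell pub-balaban; `B4Lemma21Region` is the b2b lineage's).

WHAT IS PRINTED.  p. 572 [PDF 2], verbatim: «The operators we are going to define depend on A through the function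
U(A) = e^{qeηA}, q is an antisymmetric N × N matrix, where e is a real parameter. (1.2)»; «We consider all these
operators under the assumption that the vector field A is regular on Ω in the sense that |(∂^η_μ A_ν)(x)| ≦
c(e(L^kε))^{β−1} … (1.7)».  p. 573 [PDF 3]: «Theorem (Proposition 2.1 of [1]). For α<1 there exist positive
constants δ₀, c₀, R₀ independent of A, k, Ω and depending on d, M only, c₀ on α also, such that for e sufficiently
small and for an arbitrary function f : Ω → R^N, we have [(1.9)] … [(1.10)] … [(1.11)] … [(1.12)]»; «This theorem
implies in particular the Proposition 2.3 of [1].»  p. 574 [PDF 4]: «Proposition 2.3 of [1]. There exist positive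
constants δ₀, c₀, γ₀, γ₁ dependent on d and M only and such that for arbitrary Λ ⊂ Ω^{(k)} = Ω∩Z^d, Λ being a sum
of big blocks and for e sufficiently small, we have [(1.15)–(1.20)]»; «Proposition 3.1′ of [2]. Let Ω be a sum of
unit blocks … and let A satisfies the condition |(∂^η_μ A)(x)| ≦ O(1)p(e) … (1.21) then there exists a positive
constant γ₀ depending on d only, such that for e sufficiently small [(1.22)]»; «The theorems will be proven in
Sects. 2–4 in the order in which they were written above. The fifth section will be devoted to a general theorem
concerning operators on the unit lattice Z^d.»  The cell's series DAG (`…Balaban1983to89.Dag`, audit cell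
`pub-balaban`) binds exactly these four statements as the leaf `b4`; its `0 ≤ α` form is
`DagDischargedII.B4LeafNN famE famU famF d N := B4Ineq111ZeroNestEta.ThmPrintedNN famE ∧ B4.Prop23Printed famU ∧
B4.Prop31Printed famF ∧ B4.Sect5ThmUniform d N` (recorded there as discharged of conjunct 1 at ZERO field only,
`ofPrintedAllXPN_withNestFamE_b4_iff`).

WHAT THIS MODULE PROVES (kernel-checked; zero `sorry`; NO `def`; no new `Prop` fact; axioms standard).
* §1 **`leafNN_torusPairFam`** / **`leafNN_regionPairFam`** — for every orthogonal one-parameter flow with the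
  Lipschitz bound `|(U(t) − 1)v|² ≦ (ℓ₁t)²|v|²`, every `d` (lattice `ℤ^{d+1}`), `L = ℓ + 1 ≧ 2`, windows
  `0 < a₋ ≦ a₊`, `m²₊`, (1.7)-constants `c ≧ 0`, `β > 0`, Prop. 2.3's `a′ > 0`, Prop. 3.1′'s `(a, m², O(1), a₀, p)`
  and every `(d₅, N₅)`: THE CONJUNCTION `ThmPrintedNN famE ∧ Prop23Printed famU ∧ Prop31Printed famF ∧
  Sect5ThmUniform d₅ N₅` — the body of `DagDischargedII.B4LeafNN famE famU famF d₅ N₅`, `Iff.rfl` — with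
  `famE :=` the TORUS region-pair family `B4TorusPairFam.torusPairFam` (resp. the LATTICE region-pair family
  `B4ThmRegionPairEta.regionPairFam`) at block size `Kmod`, `famU := B4Prop23RegularWindow.regularFieldRegionsW`
  (nested finite unions of `L`-blocks, every `Λ`, `a_k ∈ [a₋,a₊]`), `famF := B4Prop31Regular.regularFormSetting`
  (every finite union of unit blocks); `_exp` twins for the printed link variables `U = e^{tq}`, EVERY antisymmetric
  `q` (hypothesis-free in the flow).  This is the first inhabitant of the leaf's four conjuncts TOGETHER at a
  background field `A ≠ 0` (every (1.7)- resp. (1.21)-regular field is an instance of the families).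
* §2 NON-VACUITY of the antecedents of every family conjunct at every threshold: `prop23_antecedents_met`,
  `prop31_antecedents_met` (new, zero-field witnesses), and by name `B4ThmTorusPairEta.hypotheses_met` /
  `B4ThmRegionPairEta.hypotheses_met`; packaged with §1 in **`leafNN_torusPairFam_nonvacuous`**.
* §3 **`companions_regular`** — the paper's other named statements at a regular field, by name, in one conjunction:
  (1.8) `Claim18Printed` on both region-pair families, Lemma 2.1 `Lemma21Printed` on the regular-cube family, Lemma
  2.2 `Lemma22Printed` on the cube-configuration and on the general regular-field families, Corollary 2.3
  `Cor23Printed` on both region-pair families; `_exp` twin.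
HONEST SCOPE.  Nothing is re-proved: scope, constants and located readings are exactly those of the cited modules
(abelian one-parameter flow = the print's (1.2); component fields; staircase contours; Euclidean site norms; windows
`[a₋,a₊] × [0,m²₊]`; `0 ≦ α < 1` in `ThmPrintedNN` (referee ruling G-ref1-32: the literal «α < 1» with `α < 0` is
refuted on zero-field carriers, `B4Thm19ZeroBoxNegAlpha`); the restriction `dist(·, Ω^c) ≧ R₀` live except for
`Ω = T_η`; Prop. 3.1′'s `γ₀` depends on `(d, a, m²)` (print: «on d only»); Prop. 2.3 by the printed §5 route, not
the §3 route).  The typed leaf `B4.LeafB4` itself (conjunct 1 = `B4.ThmPrinted`, literal «α < 1») is NOT claimed.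
The module `…DagDischargedII` is not imported (it is a standalone leaf of the import graph by its owner's rule); the
audit cell may record §1 against `B4LeafNN` by `Iff.rfl`.
-/

namespace Literature.MathematicalPhysics.QuantumFieldTheory.Balaban1983to89.B4LeafRegular

open Literature.MathematicalPhysics.QuantumFieldTheory.Balaban1983to89.B4 (Prop23Printed Prop31Printed Sect5ThmUniform
  Claim18Printed Cor23Printed Lemma21Printed Lemma22Printed)
open Literature.MathematicalPhysics.QuantumFieldTheory.Balaban1983to89.B4Ineq111ZeroNestEta (ThmPrintedNN)
open Literature.MathematicalPhysics.QuantumFieldTheory.Balaban1983to89.B4GaugeCovariance (OrthFlow)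
open Literature.MathematicalPhysics.QuantumFieldTheory.Balaban1983to89.B4Lower18 (fineDom)
open Literature.MathematicalPhysics.QuantumFieldTheory.Balaban1983to89.B4Lower18Regular (e1)
open Literature.MathematicalPhysics.QuantumFieldTheory.Balaban1983to89.B4Eq12ExpFlow (expFlow expFlow_ell_nonneg
  expFlow_lipschitz)
open Literature.MathematicalPhysics.QuantumFieldTheory.Balaban1983to89.B4ThmRegionPairEta (RegionPairInst regionPairFam
  Kmod thmPrintedNN_regionPairFam claim18Printed_regionPairFam)
open Literature.MathematicalPhysics.QuantumFieldTheory.Balaban1983to89.B4TorusPairFam (TorusPairInst torusPairFam)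
open Literature.MathematicalPhysics.QuantumFieldTheory.Balaban1983to89.B4ThmTorusPairEta (thmPrintedNN_torusPairFam
  claim18Printed_torusPairFam)
open Literature.MathematicalPhysics.QuantumFieldTheory.Balaban1983to89.B4Prop23RegularFamily (RegularRegionIdx
  regularFieldRegions)
open Literature.MathematicalPhysics.QuantumFieldTheory.Balaban1983to89.B4Prop23RegularWindow (RegularRegionIdxW
  regularFieldRegionsW prop23Printed_regularWindow)
open Literature.MathematicalPhysics.QuantumFieldTheory.Balaban1983to89.B4Prop31Regular (RegularFormInstance
  regularFormSetting prop31Printed_regularRegion)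
open Literature.MathematicalPhysics.QuantumFieldTheory.Balaban1983to89.B4Sect5Proof (sect5ThmUniform_holds)
open Literature.MathematicalPhysics.QuantumFieldTheory.Balaban1983to89.B4Lemma21Region (regularCube
  lemma21Printed_regularRegion)
open Literature.MathematicalPhysics.QuantumFieldTheory.Balaban1983to89.B4Lemma22RegularCubeFam (cubeFieldFam
  lemma22Printed_cubeFieldFam)
open Literature.MathematicalPhysics.QuantumFieldTheory.Balaban1983to89.B4Lemma22RegFieldFam (regFieldFam
  lemma22Printed_regFieldFam)
open Literature.MathematicalPhysics.QuantumFieldTheory.Balaban1983to89.B4Cor23RegionPairFam (cor23Printed_regionPairFam)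
open Literature.MathematicalPhysics.QuantumFieldTheory.Balaban1983to89.B4Cor23TorusPairFam (cor23Printed_torusPairFam)
open scoped Matrix

noncomputable section

variable {ι : Type} [Fintype ι] [DecidableEq ι]

/-! ## §1. The four conjuncts of the DAG leaf `b4`, together, at a regular field -/

section Leaf

variable (F : OrthFlow ι) {ℓ₁ : ℝ} (hℓ₁ : 0 ≤ ℓ₁)
  (hLip : ∀ t (v : ι → ℝ), ((F.U t - 1) *ᵥ v) ⬝ᵥ ((F.U t - 1) *ᵥ v) ≤ (ℓ₁ * t) ^ 2 * (v ⬝ᵥ v))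
  (d ℓ : ℕ) (hℓ : 1 ≤ ℓ) (amin aplus m2plus : ℝ) (ha : 0 < amin) (hap : amin ≤ aplus)
  (creg β : ℝ) (hcreg : 0 ≤ creg) (hβ : 0 < β) {a' : ℝ} (ha' : 0 < a')
  {a m2 C a₀ p : ℝ} (ha0 : 0 < a) (hm : 0 ≤ m2) (hC : 0 ≤ C) (ha₀ : 0 ≤ a₀) (hp : 0 < p) (d₅ N₅ : ℕ)

include hap hcreg hβ ha' ha0 hm hC ha₀ hp in
/-- **THE DAG LEAF `b4` IN ITS `0 ≤ α` FORM, ALL FOUR CONJUNCTS, ON THE TORUS REGION-PAIR FAMILY AT A (1.7)-REGULAR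
FIELD**: Theorem p. 573 (1.9)–(1.12) (`ThmPrintedNN`, torus pairs `Ω ⊂ Ω₀ ⊂ T_η`, block size `Kmod`) ∧ «Proposition
2.3 of [1]» (1.15)–(1.20) (`Prop23Printed`, nested finite unions of `L = ℓ+1`-blocks, every `Λ`, `a_k ∈ [a₋,a₊]`)
∧ «Proposition 3.1′ of [2]» (1.21)–(1.22) (`Prop31Printed`, every finite union of unit blocks) ∧ the Sect. 5
Theorem (`Sect5ThmUniform d₅ N₅`) — the body of `DagDischargedII.B4LeafNN` for these families.
[cite: Balaban1983RegularityDecay, Theorem (1.9)–(1.12) p.573; Prop. 2.3 of [1] (1.15)–(1.20) p.574; Prop. 3.1′ of [2] (1.21)–(1.22) p.574; Sect. 5 Theorem p.594] -/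
theorem leafNN_torusPairFam :
    ThmPrintedNN (torusPairFam F d ℓ amin aplus m2plus creg β (Kmod F hℓ₁ hLip d ℓ hℓ amin aplus m2plus ha)) ∧
    Prop23Printed (regularFieldRegionsW (d := d) F (Nat.succ_le_succ (Nat.zero_le ℓ) : 1 ≤ ℓ + 1)
      amin aplus a' creg β m2plus) ∧
    Prop31Printed (regularFormSetting (d := d) F a m2 C a₀ p) ∧
    Sect5ThmUniform d₅ N₅ :=
  ⟨thmPrintedNN_torusPairFam F hℓ₁ hLip d ℓ hℓ amin aplus m2plus ha creg β hcreg hβ,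
   prop23Printed_regularWindow F hℓ₁ hLip _ ha hap ha' hcreg hβ m2plus,
   prop31Printed_regularRegion F hℓ₁ hLip ha0 hm hC ha₀ hp,
   sect5ThmUniform_holds d₅ N₅⟩

include hap hcreg hβ ha' ha0 hm hC ha₀ hp in
/-- **THE SAME FOUR CONJUNCTS WITH THE LATTICE REGION-PAIR FAMILY** as the `η`-family: Theorem p. 573 on general pairs
`Ω ⊂ Ω₀` of finite unions of big blocks in `ηℤ^{d+1}` (`B4ThmRegionPairEta.regionPairFam`, restriction `R₀` live).
[cite: Balaban1983RegularityDecay, Theorem (1.9)–(1.12) p.573; Prop. 2.3 of [1] (1.15)–(1.20) p.574; Prop. 3.1′ of [2] (1.21)–(1.22) p.574; Sect. 5 Theorem p.594] -/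
theorem leafNN_regionPairFam :
    ThmPrintedNN (regionPairFam F d ℓ amin aplus m2plus creg β (Kmod F hℓ₁ hLip d ℓ hℓ amin aplus m2plus ha)) ∧
    Prop23Printed (regularFieldRegionsW (d := d) F (Nat.succ_le_succ (Nat.zero_le ℓ) : 1 ≤ ℓ + 1)
      amin aplus a' creg β m2plus) ∧
    Prop31Printed (regularFormSetting (d := d) F a m2 C a₀ p) ∧
    Sect5ThmUniform d₅ N₅ :=
  ⟨thmPrintedNN_regionPairFam F hℓ₁ hLip d ℓ hℓ amin aplus m2plus ha creg β hcreg hβ,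
   prop23Printed_regularWindow F hℓ₁ hLip _ ha hap ha' hcreg hβ m2plus,
   prop31Printed_regularRegion F hℓ₁ hLip ha0 hm hC ha₀ hp,
   sect5ThmUniform_holds d₅ N₅⟩

end Leaf

/-! ## §2. Non-vacuity of the antecedents -/

section NonVacuity

variable (F : OrthFlow ι) (d : ℕ)

/-- **NON-VACUITY, Prop. 2.3 family**: for every threshold `e₁ > 0` the family `regularFieldRegionsW F hL a₋ a₊ a′ c β
m²₊` (`a₋ ≤ a₊`, `0 ≤ m²₊`, `c ≥ 0`) has a member whose antecedents `regular`, `bigBlocks`, `0 < e ≤ e₁` hold (the zero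
field on one `L`-block, `Λ = ∅`, `m² = 0`, `a_k = a₋`, mesh 1). [cite: Balaban1983RegularityDecay, Prop. 2.3 of [1] p.574 «for e sufficiently small», dictionary] -/
theorem prop23_antecedents_met {L : ℕ} (hL : 1 ≤ L) {aminus aplus : ℝ} (hap : aminus ≤ aplus) (a' : ℝ) {c : ℝ}
    (hc : 0 ≤ c) (β : ℝ) {m2max : ℝ} (hm : 0 ≤ m2max) {e₁ : ℝ} (he₁ : 0 < e₁) :
    ∃ i : RegularRegionIdxW d ι L aminus aplus m2max,
      (regularFieldRegionsW (d := d) F hL aminus aplus a' c β m2max i).regular ∧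
      (regularFieldRegionsW (d := d) F hL aminus aplus a' c β m2max i).bigBlocks ∧
      0 < (regularFieldRegionsW (d := d) F hL aminus aplus a' c β m2max i).e ∧
      (regularFieldRegionsW (d := d) F hL aminus aplus a' c β m2max i).e ≤ e₁ := by
  let j : RegularRegionIdx d ι L m2max :=
    { n := 1
      hn := le_rfl
      m2 := 0
      hm := le_rfl
      hm' := hm
      Zc := {0}
      Z₀c := {0}
      hsub := Finset.Subset.refl _
      Λ := ∅
      Ac := fun _ _ => 0
      e := e₁ }
  let i : RegularRegionIdxW d ι L aminus aplus m2max := { ak := aminus, hak := le_rfl, hak' := hap, idx := j }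
  refine ⟨i, ?_, trivial, he₁, le_rfl⟩
  intro x _ μ ν
  change |(0 : ℝ) - 0| ≤ c * e₁ ^ (β - 1) / ((1 : ℕ) : ℝ)
  rw [sub_self, abs_zero]
  positivity

/-- **NON-VACUITY, Prop. 3.1′ family**: for every threshold `e₁ > 0` the family `regularFormSetting F a m² C a₀ p`
(`C, a₀ ≥ 0`) has a member whose antecedents `unitBlocks`, `reg121` (1.21), `0 < e ≤ e₁` hold (the zero field on one
unit block, mesh 1, charge `min e₁ 1`). [cite: Balaban1983RegularityDecay, Prop. 3.1′ of [2] (1.21) p.574 «for e sufficiently small», dictionary] -/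
theorem prop31_antecedents_met (a m2 : ℝ) {C a₀ : ℝ} (hC : 0 ≤ C) (ha₀ : 0 ≤ a₀) (p : ℝ) {e₁ : ℝ}
    (he₁ : 0 < e₁) :
    ∃ i : RegularFormInstance d,
      (regularFormSetting (d := d) F a m2 C a₀ p i).unitBlocks ∧
      (regularFormSetting (d := d) F a m2 C a₀ p i).reg121 ∧
      0 < (regularFormSetting (d := d) F a m2 C a₀ p i).e ∧
      (regularFormSetting (d := d) F a m2 C a₀ p i).e ≤ e₁ := by
  let i : RegularFormInstance d := { n := 1, hn := le_rfl, Ωc := {0}, e := min e₁ 1, Ac := fun _ _ => 0 }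
  have he : 0 < min e₁ 1 := lt_min he₁ one_pos
  refine ⟨i, trivial, ?_, he, min_le_left _ _⟩
  intro x _ μ ν
  change |(0 : ℝ) - 0| ≤ C * B2.pFn a₀ p (min e₁ 1) / ((1 : ℕ) : ℝ)
  rw [sub_self, abs_zero]
  have hlog : 0 ≤ Real.log (min e₁ 1)⁻¹ := Real.log_nonneg (one_le_inv_iff₀.2 ⟨he, min_le_right _ _⟩)
  have hpFn : 0 ≤ B2.pFn a₀ p (min e₁ 1) := by
    unfold B2.pFn
    exact mul_nonneg ha₀ (Real.rpow_nonneg (by linarith) _)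
  positivity

/-- **THE LEAF `b4` AT A REGULAR FIELD, NON-VACUOUSLY** (torus `η`-family; printed link variables `U = e^{tq}` handled
in `leafNN_torusPairFam_exp`): the four conjuncts of `leafNN_torusPairFam` AND, for every threshold `e₁ > 0`, members
of each of the three families meeting that conjunct's antecedents with coupling `≤ e₁` — so none of the three family
conjuncts is discharged vacuously. [cite: Balaban1983RegularityDecay, Theorem p.573; Props. 2.3 / 3.1′ p.574; Sect. 5 Theorem p.594] -/
theorem leafNN_torusPairFam_nonvacuous {ℓ₁ : ℝ} (hℓ₁ : 0 ≤ ℓ₁)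
    (hLip : ∀ t (v : ι → ℝ), ((F.U t - 1) *ᵥ v) ⬝ᵥ ((F.U t - 1) *ᵥ v) ≤ (ℓ₁ * t) ^ 2 * (v ⬝ᵥ v))
    (ℓ : ℕ) (hℓ : 1 ≤ ℓ) (amin aplus m2plus : ℝ) (ha : 0 < amin) (hap : amin ≤ aplus) (hm2 : 0 ≤ m2plus)
    (creg β : ℝ) (hcreg : 0 ≤ creg) (hβ : 0 < β) {a' : ℝ} (ha' : 0 < a')
    {a m2 C a₀ p : ℝ} (ha0 : 0 < a) (hm : 0 ≤ m2) (hC : 0 ≤ C) (ha₀ : 0 ≤ a₀) (hp : 0 < p) (d₅ N₅ : ℕ) :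
    (ThmPrintedNN (torusPairFam F d ℓ amin aplus m2plus creg β (Kmod F hℓ₁ hLip d ℓ hℓ amin aplus m2plus ha)) ∧
      Prop23Printed (regularFieldRegionsW (d := d) F (Nat.succ_le_succ (Nat.zero_le ℓ) : 1 ≤ ℓ + 1)
        amin aplus a' creg β m2plus) ∧
      Prop31Printed (regularFormSetting (d := d) F a m2 C a₀ p) ∧
      Sect5ThmUniform d₅ N₅) ∧
    (∀ e₁ : ℝ, 0 < e₁ →
      (∃ i : TorusPairInst d ℓ amin aplus m2plus,
        (torusPairFam F d ℓ amin aplus m2plus creg β (Kmod F hℓ₁ hLip d ℓ hℓ amin aplus m2plus ha) i).regular ∧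
        (torusPairFam F d ℓ amin aplus m2plus creg β (Kmod F hℓ₁ hLip d ℓ hℓ amin aplus m2plus ha) i).bigBlocks ∧
        0 < (torusPairFam F d ℓ amin aplus m2plus creg β (Kmod F hℓ₁ hLip d ℓ hℓ amin aplus m2plus ha) i).e ∧
        (torusPairFam F d ℓ amin aplus m2plus creg β (Kmod F hℓ₁ hLip d ℓ hℓ amin aplus m2plus ha) i).e ≤ e₁) ∧
      (∃ i : RegularRegionIdxW d ι (ℓ + 1) amin aplus m2plus,
        (regularFieldRegionsW (d := d) F (Nat.succ_le_succ (Nat.zero_le ℓ) : 1 ≤ ℓ + 1)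
          amin aplus a' creg β m2plus i).regular ∧
        (regularFieldRegionsW (d := d) F (Nat.succ_le_succ (Nat.zero_le ℓ) : 1 ≤ ℓ + 1)
          amin aplus a' creg β m2plus i).bigBlocks ∧
        0 < (regularFieldRegionsW (d := d) F (Nat.succ_le_succ (Nat.zero_le ℓ) : 1 ≤ ℓ + 1)
          amin aplus a' creg β m2plus i).e ∧
        (regularFieldRegionsW (d := d) F (Nat.succ_le_succ (Nat.zero_le ℓ) : 1 ≤ ℓ + 1)
          amin aplus a' creg β m2plus i).e ≤ e₁) ∧
      (∃ i : RegularFormInstance d,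
        (regularFormSetting (d := d) F a m2 C a₀ p i).unitBlocks ∧
        (regularFormSetting (d := d) F a m2 C a₀ p i).reg121 ∧
        0 < (regularFormSetting (d := d) F a m2 C a₀ p i).e ∧
        (regularFormSetting (d := d) F a m2 C a₀ p i).e ≤ e₁)) := by
  have hK1 : 1 ≤ Kmod F hℓ₁ hLip d ℓ hℓ amin aplus m2plus ha :=
    le_trans (by norm_num)
      (Classical.choose_spec (B4ThmRegionPairEta.region_pair_members F hℓ₁ hLip d ℓ hℓ amin aplus m2plus ha)).1
  refine ⟨leafNN_torusPairFam F hℓ₁ hLip d ℓ hℓ amin aplus m2plus ha hap creg β hcreg hβ ha' ha0 hm hC ha₀ hp d₅ N₅,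
    fun e₁ he₁ => ⟨?_, ?_, ?_⟩⟩
  · exact B4ThmTorusPairEta.hypotheses_met F d ℓ hap hm2 creg β hcreg _ hK1 e₁ he₁
  · exact prop23_antecedents_met F d _ hap a' hcreg β hm2 he₁
  · exact prop31_antecedents_met F d a m2 hC ha₀ p he₁

end NonVacuity

/-! ## §3. The companions: (1.8), Lemma 2.1, Lemma 2.2, Corollary 2.3 at a regular field, by name -/

section Companions

variable (F : OrthFlow ι) {ℓ₁ : ℝ} (hℓ₁ : 0 ≤ ℓ₁)
  (hLip : ∀ t (v : ι → ℝ), ((F.U t - 1) *ᵥ v) ⬝ᵥ ((F.U t - 1) *ᵥ v) ≤ (ℓ₁ * t) ^ 2 * (v ⬝ᵥ v))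
  (d ℓ : ℕ) (hℓ : 1 ≤ ℓ) (amin aplus m2plus : ℝ) (ha : 0 < amin) (creg β : ℝ) (hcreg : 0 ≤ creg) (hβ : 0 < β)
  (K M S : ℕ) (hK : 1 ≤ K)

include hℓ₁ hLip hℓ ha hcreg hβ hK in
/-- **THE OTHER NAMED STATEMENTS OF THE PAPER AT A (1.7)-REGULAR FIELD `A ≠ 0`, IN ONE CONJUNCTION, BY NAME**: (1.8)
`Claim18Printed` on the torus and on the lattice region-pair families (every block size `K`); Lemma 2.1
`Lemma21Printed` on the regular-cube family (cubes of `M` blocks of size `K`, coefficient `a₋`); Lemma 2.2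
`Lemma22Printed` on the cube-configuration family (`Ã_j = A₀ + θ_jA′` on boxes of `≤ S` blocks of size `K`) and on the
general regular-field family (component fields on boxes of `≤ S` blocks, constant on the boundary collar); Corollary
2.3 (2.30) with its `δG` clause `Cor23Printed` on the lattice and on the torus region-pair families.
[cite: Balaban1983RegularityDecay, (1.8) p.573; Lemma 2.1 (2.15) p.577; Lemma 2.2 (2.16)–(2.17) pp.577–578; Corollary 2.3 (2.30) pp.580–581] -/
theorem companions_regular :
    Claim18Printed (torusPairFam F d ℓ amin aplus m2plus creg β K) ∧
    Claim18Printed (regionPairFam F d ℓ amin aplus m2plus creg β K) ∧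
    Lemma21Printed (regularCube (d := d) F amin creg β M K) ∧
    Lemma22Printed (cubeFieldFam F d ℓ amin aplus m2plus creg β S K) (d + 1) ∧
    Lemma22Printed (regFieldFam F d ℓ amin aplus m2plus creg β S) (d + 1) ∧
    Cor23Printed (regionPairFam F d ℓ amin aplus m2plus creg β K) ∧
    Cor23Printed (torusPairFam F d ℓ amin aplus m2plus creg β K) :=
  ⟨claim18Printed_torusPairFam F hℓ₁ hLip d ℓ hℓ amin aplus m2plus ha creg β hcreg hβ K,
   claim18Printed_regionPairFam F hℓ₁ hLip d ℓ hℓ amin aplus m2plus ha creg β hcreg hβ K,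
   lemma21Printed_regularRegion F hℓ₁ hLip ha hcreg hβ M K,
   lemma22Printed_cubeFieldFam F hℓ₁ hLip d ℓ hℓ amin aplus m2plus ha creg β hcreg hβ S K hK,
   lemma22Printed_regFieldFam F hℓ₁ hLip d ℓ hℓ amin aplus m2plus ha creg β hcreg hβ S,
   cor23Printed_regionPairFam F hℓ₁ hLip d ℓ hℓ amin aplus m2plus ha creg β hcreg hβ K,
   cor23Printed_torusPairFam F hℓ₁ hLip d ℓ hℓ amin aplus m2plus ha creg β hcreg hβ K⟩

end Companions

/-! ## §4. The printed link variables (1.2): `U = e^{tq}`, every antisymmetric `q` -/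

section Exp

variable (q : Matrix ι ι ℝ) (hq : qᵀ = -q) (d ℓ : ℕ) (hℓ : 1 ≤ ℓ) (amin aplus m2plus : ℝ) (ha : 0 < amin)
  (hap : amin ≤ aplus) (creg β : ℝ) (hcreg : 0 ≤ creg) (hβ : 0 < β)

include hap hcreg hβ in
/-- **THE LEAF `b4` AT A REGULAR FIELD FOR THE PRINTED LINK VARIABLES (1.2)** `U(A) = e^{qeηA}`, ANY antisymmetric
`q` (any `N`): `leafNN_torusPairFam` with the flow hypothesis discharged by `B4Eq12ExpFlow.expFlow_lipschitz`.
[cite: Balaban1983RegularityDecay, (1.2) p.572; Theorem p.573; Props. 2.3 / 3.1′ p.574; Sect. 5 Theorem p.594] -/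
theorem leafNN_torusPairFam_exp {a' : ℝ} (ha' : 0 < a') {a m2 C a₀ p : ℝ} (ha0 : 0 < a) (hm : 0 ≤ m2)
    (hC : 0 ≤ C) (ha₀ : 0 ≤ a₀) (hp : 0 < p) (d₅ N₅ : ℕ) :
    ThmPrintedNN (torusPairFam (expFlow q hq) d ℓ amin aplus m2plus creg β
      (Kmod (expFlow q hq) (expFlow_ell_nonneg q) (expFlow_lipschitz q hq) d ℓ hℓ amin aplus m2plus ha)) ∧
    Prop23Printed (regularFieldRegionsW (d := d) (expFlow q hq) (Nat.succ_le_succ (Nat.zero_le ℓ) : 1 ≤ ℓ + 1)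
      amin aplus a' creg β m2plus) ∧
    Prop31Printed (regularFormSetting (d := d) (expFlow q hq) a m2 C a₀ p) ∧
    Sect5ThmUniform d₅ N₅ :=
  leafNN_torusPairFam (expFlow q hq) (expFlow_ell_nonneg q) (expFlow_lipschitz q hq) d ℓ hℓ amin aplus m2plus ha hap
    creg β hcreg hβ ha' ha0 hm hC ha₀ hp d₅ N₅

include hap hcreg hβ in
/-- The lattice-family twin of `leafNN_torusPairFam_exp`. [cite: Balaban1983RegularityDecay, (1.2) p.572; Theorem p.573; Props. 2.3 / 3.1′ p.574; Sect. 5 Theorem p.594] -/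
theorem leafNN_regionPairFam_exp {a' : ℝ} (ha' : 0 < a') {a m2 C a₀ p : ℝ} (ha0 : 0 < a) (hm : 0 ≤ m2)
    (hC : 0 ≤ C) (ha₀ : 0 ≤ a₀) (hp : 0 < p) (d₅ N₅ : ℕ) :
    ThmPrintedNN (regionPairFam (expFlow q hq) d ℓ amin aplus m2plus creg β
      (Kmod (expFlow q hq) (expFlow_ell_nonneg q) (expFlow_lipschitz q hq) d ℓ hℓ amin aplus m2plus ha)) ∧
    Prop23Printed (regularFieldRegionsW (d := d) (expFlow q hq) (Nat.succ_le_succ (Nat.zero_le ℓ) : 1 ≤ ℓ + 1)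
      amin aplus a' creg β m2plus) ∧
    Prop31Printed (regularFormSetting (d := d) (expFlow q hq) a m2 C a₀ p) ∧
    Sect5ThmUniform d₅ N₅ :=
  leafNN_regionPairFam (expFlow q hq) (expFlow_ell_nonneg q) (expFlow_lipschitz q hq) d ℓ hℓ amin aplus m2plus ha
    hap creg β hcreg hβ ha' ha0 hm hC ha₀ hp d₅ N₅

include hℓ ha hcreg hβ in
/-- **THE COMPANIONS FOR THE PRINTED LINK VARIABLES (1.2)**, any antisymmetric `q`.
[cite: Balaban1983RegularityDecay, (1.2) p.572; (1.8) p.573; Lemma 2.1 p.577; Lemma 2.2 pp.577–578; Corollary 2.3 pp.580–581] -/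
theorem companions_regular_exp (K M S : ℕ) (hK : 1 ≤ K) :
    Claim18Printed (torusPairFam (expFlow q hq) d ℓ amin aplus m2plus creg β K) ∧
    Claim18Printed (regionPairFam (expFlow q hq) d ℓ amin aplus m2plus creg β K) ∧
    Lemma21Printed (regularCube (d := d) (expFlow q hq) amin creg β M K) ∧
    Lemma22Printed (cubeFieldFam (expFlow q hq) d ℓ amin aplus m2plus creg β S K) (d + 1) ∧
    Lemma22Printed (regFieldFam (expFlow q hq) d ℓ amin aplus m2plus creg β S) (d + 1) ∧
    Cor23Printed (regionPairFam (expFlow q hq) d ℓ amin aplus m2plus creg β K) ∧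
    Cor23Printed (torusPairFam (expFlow q hq) d ℓ amin aplus m2plus creg β K) :=
  companions_regular (expFlow q hq) (expFlow_ell_nonneg q) (expFlow_lipschitz q hq) d ℓ hℓ amin aplus m2plus ha
    creg β hcreg hβ K M S hK

end Exp

end

end Literature.MathematicalPhysics.QuantumFieldTheory.Balaban1983to89.B4LeafRegular
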